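import Literature.Probability.LatticeModels.IntersectionClusteringInduction
import Literature.Probability.LatticeModels.IntersectionSecondMoment
import Literature.Probability.LatticeModels.CrossingUniqueness
import Literature.Probability.LatticeModels.CrossingEventsBounds
import HarnessLib

/-!
# The intersection property on a finite graph (Aizenman–Duminil-Copin 2021, Lemma 4.4 / Lemma 6.2): assembly

Topic `Literature/Probability/LatticeModels`. Theorems only (no definition, no named fact).

M. Aizenman, H. Duminil-Copin, *Marginal triviality of the scaling limits of critical 4D Ising and
`φ⁴₄` models*, Ann. of Math. **194** (2021), arXiv:1912.07973 [AizenmanDuminilCopinAnnals2021],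
**Lemma 6.2** (intersection property, p. 21; proof = proof of Lemma 4.4, pp. 11–12, "Restricting our
attention to the case of `y` belonging to a regular scale …, we follow the same proof as the one of
the conditional version"): `P^{0y,0y,∅,∅}_β[I_k] ≥ c`.

The printed proof has three parts, all of which the tree already holds on a finite simple graph `G`
with couplings `K ≥ 0` (un-normalised `ℝ≥0∞` current sums):

1. the second-moment method on `|𝓜|`, `𝓜 = C_{n₁+n₃}(u) ∩ C_{n₂+n₄}(u) ∩ Ann(m,M)`
   (`IntersectionSecondMoment.lean`: first moment `Current.tsum_prodWeight_mul_interCount`, second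
   moment with Proposition A.3 `Current.sq_mul_tsum_prodWeight_mul_interCount_sq_le`, Cauchy–Schwarz
   `Current.tsum_prodWeight_mul_interCount_sq_le`);
2. "If the event `{𝓜 ≠ ∅}` occurs but not `I_k`, then one of the following four events must occur"
   (`CrossingUniqueness.lean`: `Current.ikEvent_of_not_F`);
3. the bounds on `F₁,…,F₄` (`CrossingEventsBounds.lean`: `Current.tsum_epairWeight_fOne_mul_le`,
   `Current.tsum_epairWeight_fBand_mul_le`).

This file assembles them ("For `ℓ_0` large enough the sum of the four probabilities does not exceed
half of the constant `c_5` in (4.6), and the main statement follows", p. 12) into the inequality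
`c · Z[∅]Z[uy] · Z[∅]Z[uy] ≤ ∑ 1{∂}w⁴ 𝟙[I_k]` under two hypotheses on the two-point sums that appear
in 1 and 3 — `Current.ikMass_lower_bound_prod` (in the source layout `P^{uy,∅} ⊗ P^{uy,∅}` of
`IntersectionSecondMoment`), `Current.ikMass_lower_bound` (in the layout `Current.fourMass` of
`IntersectionClusteringInduction`, the one consumed by `improvedTreeDiagramBound_of_intersection_and_mixing`),
and `Current.ikMass_lower_bound_of_twoPoint` (the same with the current sums expressed through a
normalised two-point function `g`, `Z[{a}Δ{b}] = Z[∅] g(a,b)`, so that the hypotheses become the two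
real inequalities checked on `ℤ⁴` from the infrared bound and the regularity of `y`).

## References

* M. Aizenman, H. Duminil-Copin, Ann. of Math. 194 (2021), arXiv:1912.07973, §4.2, Lemma 4.4 and its
  proof (pp. 11–12); §6.1, Lemma 6.2 (p. 21) [AizenmanDuminilCopinAnnals2021].
-/

noncomputable section

open Finset
open scoped symmDiff ENNReal

namespace Literature.Probability.LatticeModels

variable {V : Type*} [Fintype V] [DecidableEq V] {G : SimpleGraph V} [DecidableRel G.Adj]

namespace Current

variable {K : G.edgeFinset → ℝ}

/-! ### The two source layouts -/

/-- The weight of `P^{uy,uy,∅,∅}` in the layout of `Current.fourWeight` (sources on the second current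
of each pair) is the weight `Current.prodWeight` (sources on the first current) of the pairs with their
two currents exchanged. [folklore] -/
theorem fourWeight_eq_prodWeight_swap (K : G.edgeFinset → ℝ) (u y : V) (pq : FourCfg G) :
    fourWeight K u y y pq = prodWeight K u y y (pq.1.swap, pq.2.swap) := by
  show epairWeight K ∅ ({y} ∆ {u}) pq.1 * epairWeight K ∅ ({y} ∆ {u}) pq.2 =
    epairWeight K ({u} ∆ {y}) ∅ pq.1.swap * epairWeight K ({u} ∆ {y}) ∅ pq.2.swap
  rw [epairWeight_swap, epairWeight_swap, symmDiff_comm]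

/-- `Current.fourMass K u y y Φ` as a `prodWeight`-sum (exchange the two currents of each pair).
[folklore] -/
theorem fourMass_eq_tsum_prodWeight_swap (K : G.edgeFinset → ℝ) (u y : V) (Φ : FourCfg G → ℝ≥0∞) :
    fourMass K u y y Φ = ∑' pq : FourCfg G, prodWeight K u y y pq * Φ (pq.1.swap, pq.2.swap) := by
  unfold fourMass
  rw [← (Equiv.prodCongr (Equiv.prodComm (Current G) (Current G))
    (Equiv.prodComm (Current G) (Current G))).tsum_eq
    (fun pq : FourCfg G => prodWeight K u y y pq * Φ (pq.1.swap, pq.2.swap))]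
  refine tsum_congr fun pq => ?_
  obtain ⟨p, q⟩ := pq
  simp only [Equiv.prodCongr_apply, Equiv.coe_prodComm, Prod.map, Prod.swap_swap]
  rw [fourWeight_eq_prodWeight_swap]

/-- The normalisation in the two layouts: `fourNrm K u y y = (Z[{u}Δ{y}] Z[∅])²`. [folklore] -/
theorem fourNrm_eq_sq (K : G.edgeFinset → ℝ) (u y : V) :
    fourNrm K u y y = (ecurrentSum K ({u} ∆ {y}) * ecurrentSum K ∅) ^ 2 := by
  unfold fourNrm
  rw [symmDiff_comm]
  ring

/-- On the support of `prodWeight K u y y` the sourced currents have sources `{u} Δ {y}`. [folklore] -/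
theorem sources_of_prodWeight_ne_zero {u y : V} {pq : FourCfg G} (h : prodWeight K u y y pq ≠ 0) :
    pq.1.1.sources = {u} ∆ {y} ∧ pq.2.1.sources = {u} ∆ {y} := by
  unfold prodWeight epairWeight at h
  by_contra hno
  rw [not_and_or] at hno
  rcases hno with h1 | h2
  · exact h (by rw [if_neg (fun h' => h1 h'.1), zero_mul])
  · exact h (by rw [mul_comm, if_neg (fun h' => h2 h'.1), zero_mul])

section Metric

variable [PseudoMetricSpace V] {u : V} {rk : G.edgeFinset → ℕ}

/-! ### `{𝓜 ≠ ∅} ⊆ I_k ∪ ⋃ Fᵢ`, as an inequality of indicators against the weight -/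

open Classical in
/-- **The covering step** ("If the event `{𝓜 ≠ ∅}` occurs but not `I_k`, then one of the following
four events must occur", for both pairs), multiplied by the weight: pointwise in the four currents,
`W 𝟙[𝓜 ≠ ∅] ≤ W (𝟙[I_k] + ∑_{i,j} 𝟙[F_i(pair j)])`. [cite: AizenmanDuminilCopinAnnals2021, arXiv:1912.07973 §4.2, proof of Lemma 4.4 (p. 12)] -/
theorem prodWeight_mul_indicator_interCount_le (hstep : ∀ v w, G.Adj v w → dist u w ≤ dist u v + 1)
    (hint : ∀ v, ∃ k : ℕ, dist u v = k) (hrk : Function.Injective rk) {y : V}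
    {a n₀ m₀ M₀ N₀ b : ℕ} (han : a < n₀) (hnm : n₀ ≤ m₀) (hmM : m₀ ≤ M₀) (hMN : M₀ ≤ N₀) (hNb : N₀ < b)
    (hy : (b : ℝ) < dist u y) {W : Finset V} (hW : ∀ v, v ∈ W ↔ (a : ℝ) ≤ dist u v ∧ dist u v ≤ b)
    {A : Finset V} (hA : ∀ v ∈ A, (m₀ : ℝ) ≤ dist u v ∧ dist u v ≤ M₀) (pq : FourCfg G) :
    prodWeight K u y y pq * (if interCount A u pq.1 pq.2 = 0 then 0 else 1) ≤
      prodWeight K u y y pq *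
        ((if IkEvent W a b u (pq.1.1 + pq.1.2) (pq.2.1 + pq.2.2) then 1 else 0) +
          ((if FOne rk pq.1.1 y u n₀ a then 1 else 0) + (if FBand rk pq.1.1 pq.1.2 y u n₀ m₀ then 1 else 0) +
            (if FBand rk pq.1.1 pq.1.2 y u M₀ N₀ then 1 else 0) + (if FOne rk pq.1.1 y u b N₀ then 1 else 0)) +
          ((if FOne rk pq.2.1 y u n₀ a then 1 else 0) + (if FBand rk pq.2.1 pq.2.2 y u n₀ m₀ then 1 else 0) +
            (if FBand rk pq.2.1 pq.2.2 y u M₀ N₀ then 1 else 0) + (if FOne rk pq.2.1 y u b N₀ then 1 else 0))) := by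
  by_cases hw : prodWeight K u y y pq = 0
  · rw [hw, zero_mul, zero_mul]
  by_cases hN : interCount A u pq.1 pq.2 = 0
  · rw [if_pos hN, mul_zero]; exact bot_le
  rw [if_neg hN]
  refine mul_le_mul' le_rfl ?_
  -- one of the nine indicators is `1`
  by_cases h1 : FOne rk pq.1.1 y u n₀ a
  · rw [if_pos h1]; exact le_add_right (le_add_left (le_add_right (le_add_right (le_add_right le_rfl))))
  by_cases h2 : FBand rk pq.1.1 pq.1.2 y u n₀ m₀
  · rw [if_pos h2]; exact le_add_right (le_add_left (le_add_right (le_add_right (le_add_left le_rfl))))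
  by_cases h3 : FBand rk pq.1.1 pq.1.2 y u M₀ N₀
  · rw [if_pos h3]; exact le_add_right (le_add_left (le_add_right (le_add_left le_rfl)))
  by_cases h4 : FOne rk pq.1.1 y u b N₀
  · rw [if_pos h4]; exact le_add_right (le_add_left (le_add_left le_rfl))
  by_cases h1' : FOne rk pq.2.1 y u n₀ a
  · rw [if_pos h1']; exact le_add_left (le_add_right (le_add_right (le_add_right le_rfl)))
  by_cases h2' : FBand rk pq.2.1 pq.2.2 y u n₀ m₀
  · rw [if_pos h2']; exact le_add_left (le_add_right (le_add_right (le_add_left le_rfl)))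
  by_cases h3' : FBand rk pq.2.1 pq.2.2 y u M₀ N₀
  · rw [if_pos h3']; exact le_add_left (le_add_right (le_add_left le_rfl))
  by_cases h4' : FOne rk pq.2.1 y u b N₀
  · rw [if_pos h4']; exact le_add_left (le_add_left le_rfl)
  -- none of the eight: `I_k` holds
  obtain ⟨hs₁, hs₂⟩ := sources_of_prodWeight_ne_zero hw
  obtain ⟨x₀, hx₀A, hx₀, hx₀'⟩ := (interCount_ne_zero_iff A u pq.1 pq.2).1 hN
  have hIk : IkEvent W a b u (pq.1.1 + pq.1.2) (pq.2.1 + pq.2.2) :=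
    ikEvent_of_not_F hstep hint hrk pq.1.2 pq.2.2 han hnm hmM hMN hNb hs₁ hs₂ hy hW h1 h2 h3
      (fun h => h4 (fFour_iff_fOne.1 h)) h1' h2' h3' (fun h => h4' (fFour_iff_fOne.1 h))
      hx₀ hx₀' (hA x₀ hx₀A).1 (hA x₀ hx₀A).2
  rw [if_pos hIk]
  exact le_add_right (le_add_right le_rfl)


/-! ### Factorising the bad events over the two independent pairs -/

omit [PseudoMetricSpace V] in
/-- Fubini for a function of the first pair: `∑ W f(pair₁) = (∑_{pair} 1{∂}w w f) · Z[{o}Δ{z}] Z[∅]`. [folklore] -/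
theorem tsum_prodWeight_mul_fst (K : G.edgeFinset → ℝ) (o x z : V) (f : Current G × Current G → ℝ≥0∞) :
    ∑' pq : FourCfg G, prodWeight K o x z pq * f pq.1 =
      (∑' p : Current G × Current G, epairWeight K ({o} ∆ {x}) ∅ p * f p) *
        (ecurrentSum K ({o} ∆ {z}) * ecurrentSum K ∅) := by
  have h := tsum_prodWeight_mul_mul K o x z f (fun _ => 1)
  simp only [mul_one] at h
  rw [h, tsum_epairWeight]

omit [PseudoMetricSpace V] in
/-- Fubini for a function of the second pair: `∑ W g(pair₂) = Z[{o}Δ{x}] Z[∅] · ∑_{pair} 1{∂}w w g`. [folklore] -/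
theorem tsum_prodWeight_mul_snd (K : G.edgeFinset → ℝ) (o x z : V) (g : Current G × Current G → ℝ≥0∞) :
    ∑' pq : FourCfg G, prodWeight K o x z pq * g pq.2 =
      (ecurrentSum K ({o} ∆ {x}) * ecurrentSum K ∅) *
        ∑' q : Current G × Current G, epairWeight K ({o} ∆ {z}) ∅ q * g q := by
  have h := tsum_prodWeight_mul_mul K o x z (fun _ => 1) g
  simp only [one_mul, mul_one] at h
  rw [h, tsum_epairWeight]

omit [PseudoMetricSpace V] in
/-- The two-step bound of Proposition A.3 is finite (`K ≥ 0`). [folklore] -/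
theorem twoStepBound_ne_top' (hK : ∀ e, 0 ≤ K e) (o x v w : V) : twoStepBound K o x v w ≠ ∞ := by
  classical
  unfold twoStepBound
  exact ENNReal.add_ne_top.2
    ⟨ENNReal.mul_ne_top (ENNReal.mul_ne_top (ecurrentSum_ne_top hK _) (ecurrentSum_ne_top hK _))
        (ecurrentSum_ne_top hK _),
      ENNReal.mul_ne_top (ENNReal.mul_ne_top (ecurrentSum_ne_top hK _) (ecurrentSum_ne_top hK _))
        (ecurrentSum_ne_top hK _)⟩

/-! ### The intersection property from two hypotheses on the two-point sums -/

open Classical in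
/-- **Aizenman–Duminil-Copin 2021, Lemma 4.4 / Lemma 6.2 — the assembly, un-normalised, in the source
layout `P^{uy,∅} ⊗ P^{uy,∅}`.** On a finite graph with couplings `K ≥ 0`, a centre `u` (integer
distances changing by at most one along edges), a far source `y` (`dist(u,y) > b`), radii
`a < n₀ ≤ m₀ ≤ M₀ ≤ N₀ < b`, the annulus `W = {a ≤ dist(u,·) ≤ b}`, a set `A` of sites at distance in
`[m₀, M₀]` (the set `Ann(m,M)` of the intersection count `|𝓜|`) and sets `S_r ⊇ {dist(u,·) = r}`: write
`Z[·] = ecurrentSum K ·`, `S₁ = ∑_{v ∈ A} (Z[yv]Z[uv])²` (the first moment of `|𝓜|`, three-point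
identity), `T₂ = ∑_{v,w ∈ A} B_y(v,w)²` (the bound of Prop. A.3 on `Z[∅]²·` second moment),
`R₁ = ∑_{S_{n₀} × S_a} Z[uv]Z[vw]Z[wy]`, `R₄ = ∑_{S_b × S_{N₀}} Z[uv]Z[vw]Z[wy]` (the bounds on `F₁`, `F₄`),
`R₂ = ∑_{S_{n₀} × S_{m₀}} Z[vw]²`, `R₃ = ∑_{S_{M₀} × S_{N₀}} Z[vw]²` (the bounds on `F₂`, `F₃`). If
`S₁ ≠ 0`, `2c · Z[uy]² T₂ ≤ S₁²` ("`P[𝓜 ≠ ∅] ≥ E[|𝓜|]²/E[|𝓜|²] ≥ c₅`" with `c₅ = 2c`) and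
`2(R₁ + R₄ + Z[uy](R₂ + R₃)) ≤ c · Z[uy]Z[∅]²` ("the sum of the four probabilities does not exceed half
of the constant `c₅`", for each of the two pairs), then
`c · (Z[uy]Z[∅])² ≤ ∑ 1{∂n₁ = ∂n₂ = {u,y}} 1{∂n₃ = ∂n₄ = ∅} w⁴ 𝟙[I_k]`, i.e. `P^{uy,uy,∅,∅}[I_k] ≥ c`.
[cite: AizenmanDuminilCopinAnnals2021, arXiv:1912.07973 §4.2, Lemma 4.4 and its proof (pp. 11–12); §6.1, Lemma 6.2 (p. 21)] -/
theorem ikMass_lower_bound_prod (hK : ∀ e, 0 ≤ K e) (hrk : Function.Injective rk)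
    (hstep : ∀ v w, G.Adj v w → dist u w ≤ dist u v + 1) (hint : ∀ v, ∃ k : ℕ, dist u v = k) {y : V}
    {a n₀ m₀ M₀ N₀ b : ℕ} (han : a < n₀) (hnm : n₀ ≤ m₀) (hmM : m₀ ≤ M₀) (hMN : M₀ ≤ N₀) (hNb : N₀ < b)
    (hy : (b : ℝ) < dist u y) {W : Finset V} (hW : ∀ v, v ∈ W ↔ (a : ℝ) ≤ dist u v ∧ dist u v ≤ b)
    {A : Finset V} (hA : ∀ v ∈ A, (m₀ : ℝ) ≤ dist u v ∧ dist u v ≤ M₀)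
    {Sa Sn Sm SM SN Sb : Finset V} (hSa : ∀ v, dist u v = a → v ∈ Sa) (hSn : ∀ v, dist u v = n₀ → v ∈ Sn)
    (hSm : ∀ v, dist u v = m₀ → v ∈ Sm) (hSM : ∀ v, dist u v = M₀ → v ∈ SM)
    (hSN : ∀ v, dist u v = N₀ → v ∈ SN) (hSb : ∀ v, dist u v = b → v ∈ Sb)
    {c : ℝ≥0∞} (hc : c ≠ ∞)
    (h0 : ∑ v ∈ A, (ecurrentSum K ({y} ∆ {v}) * ecurrentSum K ({u} ∆ {v})) *
        (ecurrentSum K ({y} ∆ {v}) * ecurrentSum K ({u} ∆ {v})) ≠ 0)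
    (h1 : 2 * c * (ecurrentSum K ({u} ∆ {y}) ^ 2 *
        ∑ v ∈ A, ∑ w ∈ A, twoStepBound K u y v w * twoStepBound K u y v w) ≤
      (∑ v ∈ A, (ecurrentSum K ({y} ∆ {v}) * ecurrentSum K ({u} ∆ {v})) *
        (ecurrentSum K ({y} ∆ {v}) * ecurrentSum K ({u} ∆ {v}))) ^ 2)
    (h2 : 2 * ((∑ v ∈ Sn, ∑ w ∈ Sa, ecurrentSum K ({u} ∆ {v}) * ecurrentSum K ({v} ∆ {w}) * ecurrentSum K ({w} ∆ {y}) +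
          ∑ v ∈ Sb, ∑ w ∈ SN, ecurrentSum K ({u} ∆ {v}) * ecurrentSum K ({v} ∆ {w}) * ecurrentSum K ({w} ∆ {y})) +
        ecurrentSum K ({u} ∆ {y}) *
          (∑ v ∈ Sn, ∑ w ∈ Sm, ecurrentSum K ({v} ∆ {w}) ^ 2 +
            ∑ v ∈ SM, ∑ w ∈ SN, ecurrentSum K ({v} ∆ {w}) ^ 2)) ≤
      c * (ecurrentSum K ({u} ∆ {y}) * ecurrentSum K ∅ ^ 2)) :
    c * (ecurrentSum K ({u} ∆ {y}) * ecurrentSum K ∅) ^ 2 ≤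
      ∑' pq : FourCfg G, prodWeight K u y y pq *
        (if IkEvent W a b u (pq.1.1 + pq.1.2) (pq.2.1 + pq.2.2) then 1 else 0) := by
  -- abbreviations
  set E := ecurrentSum K (∅ : Finset V) with hE
  set P := ecurrentSum K ({u} ∆ {y}) with hP
  set S₁ := ∑ v ∈ A, (ecurrentSum K ({y} ∆ {v}) * ecurrentSum K ({u} ∆ {v})) *
      (ecurrentSum K ({y} ∆ {v}) * ecurrentSum K ({u} ∆ {v})) with hS₁
  set T₂ := ∑ v ∈ A, ∑ w ∈ A, twoStepBound K u y v w * twoStepBound K u y v w with hT₂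
  set R₁ := ∑ v ∈ Sn, ∑ w ∈ Sa,
      ecurrentSum K ({u} ∆ {v}) * ecurrentSum K ({v} ∆ {w}) * ecurrentSum K ({w} ∆ {y}) with hR₁
  set R₄ := ∑ v ∈ Sb, ∑ w ∈ SN,
      ecurrentSum K ({u} ∆ {v}) * ecurrentSum K ({v} ∆ {w}) * ecurrentSum K ({w} ∆ {y}) with hR₄
  set R₂ := ∑ v ∈ Sn, ∑ w ∈ Sm, ecurrentSum K ({v} ∆ {w}) ^ 2 with hR₂
  set R₃ := ∑ v ∈ SM, ∑ w ∈ SN, ecurrentSum K ({v} ∆ {w}) ^ 2 with hR₃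
  set IK := ∑' pq : FourCfg G, prodWeight K u y y pq *
      (if IkEvent W a b u (pq.1.1 + pq.1.2) (pq.2.1 + pq.2.2) then 1 else 0) with hIK
  have hE0 : E ≠ 0 := ecurrentSum_empty_ne_zero K
  have hEt : E ≠ ∞ := ecurrentSum_ne_top hK _
  have hPt : P ≠ ∞ := ecurrentSum_ne_top hK _
  -- Part 1: the second-moment method (`IntersectionSecondMoment`)
  set S₀ := ∑' pq : FourCfg G, prodWeight K u y y pq *
      (if interCount A u pq.1 pq.2 = 0 then 0 else 1) with hS₀
  set S₂ := ∑' pq : FourCfg G, prodWeight K u y y pq * interCount A u pq.1 pq.2 ^ 2 with hS₂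
  have hFM : ∑' pq : FourCfg G, prodWeight K u y y pq * interCount A u pq.1 pq.2 = S₁ :=
    tsum_prodWeight_mul_interCount hK A u y y
  have hSMom : E ^ 2 * S₂ ≤ T₂ := sq_mul_tsum_prodWeight_mul_interCount_sq_le hK A u y y
  have hCS : S₁ ^ 2 ≤ S₀ * S₂ := by
    have h := tsum_prodWeight_mul_interCount_sq_le K A u y y
    rwa [hFM] at h
  have hchain : S₁ ^ 2 * E ^ 2 ≤ S₀ * T₂ :=
    calc S₁ ^ 2 * E ^ 2 ≤ S₀ * S₂ * E ^ 2 := mul_le_mul' hCS le_rfl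
      _ = S₀ * (E ^ 2 * S₂) := by ring
      _ ≤ S₀ * T₂ := mul_le_mul' le_rfl hSMom
  -- Part 2: `{𝓜 ≠ ∅} ⊆ I_k ∪ ⋃ F`, summed against the weight and factorised over the two pairs
  set m₁ := ∑' p : Current G × Current G, epairWeight K ({u} ∆ {y}) ∅ p *
      (if FOne rk p.1 y u n₀ a then 1 else 0) with hm₁
  set m₂ := ∑' p : Current G × Current G, epairWeight K ({u} ∆ {y}) ∅ p *
      (if FBand rk p.1 p.2 y u n₀ m₀ then 1 else 0) with hm₂
  set m₃ := ∑' p : Current G × Current G, epairWeight K ({u} ∆ {y}) ∅ p *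
      (if FBand rk p.1 p.2 y u M₀ N₀ then 1 else 0) with hm₃
  set m₄ := ∑' p : Current G × Current G, epairWeight K ({u} ∆ {y}) ∅ p *
      (if FOne rk p.1 y u b N₀ then 1 else 0) with hm₄
  have e₁ : ∑' pq : FourCfg G, prodWeight K u y y pq * (if FOne rk pq.1.1 y u n₀ a then 1 else 0) =
      m₁ * (P * E) :=
    tsum_prodWeight_mul_fst K u y y (fun p => if FOne rk p.1 y u n₀ a then 1 else 0)
  have e₂ : ∑' pq : FourCfg G, prodWeight K u y y pq * (if FBand rk pq.1.1 pq.1.2 y u n₀ m₀ then 1 else 0) =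
      m₂ * (P * E) :=
    tsum_prodWeight_mul_fst K u y y (fun p => if FBand rk p.1 p.2 y u n₀ m₀ then 1 else 0)
  have e₃ : ∑' pq : FourCfg G, prodWeight K u y y pq * (if FBand rk pq.1.1 pq.1.2 y u M₀ N₀ then 1 else 0) =
      m₃ * (P * E) :=
    tsum_prodWeight_mul_fst K u y y (fun p => if FBand rk p.1 p.2 y u M₀ N₀ then 1 else 0)
  have e₄ : ∑' pq : FourCfg G, prodWeight K u y y pq * (if FOne rk pq.1.1 y u b N₀ then 1 else 0) =
      m₄ * (P * E) :=
    tsum_prodWeight_mul_fst K u y y (fun p => if FOne rk p.1 y u b N₀ then 1 else 0)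
  have e₁' : ∑' pq : FourCfg G, prodWeight K u y y pq * (if FOne rk pq.2.1 y u n₀ a then 1 else 0) =
      (P * E) * m₁ :=
    tsum_prodWeight_mul_snd K u y y (fun p => if FOne rk p.1 y u n₀ a then 1 else 0)
  have e₂' : ∑' pq : FourCfg G, prodWeight K u y y pq * (if FBand rk pq.2.1 pq.2.2 y u n₀ m₀ then 1 else 0) =
      (P * E) * m₂ :=
    tsum_prodWeight_mul_snd K u y y (fun p => if FBand rk p.1 p.2 y u n₀ m₀ then 1 else 0)
  have e₃' : ∑' pq : FourCfg G, prodWeight K u y y pq * (if FBand rk pq.2.1 pq.2.2 y u M₀ N₀ then 1 else 0) =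
      (P * E) * m₃ :=
    tsum_prodWeight_mul_snd K u y y (fun p => if FBand rk p.1 p.2 y u M₀ N₀ then 1 else 0)
  have e₄' : ∑' pq : FourCfg G, prodWeight K u y y pq * (if FOne rk pq.2.1 y u b N₀ then 1 else 0) =
      (P * E) * m₄ :=
    tsum_prodWeight_mul_snd K u y y (fun p => if FOne rk p.1 y u b N₀ then 1 else 0)
  have hcover : S₀ ≤ IK + 2 * ((m₁ + m₂ + m₃ + m₄) * (P * E)) := by
    calc S₀ ≤ ∑' pq : FourCfg G, prodWeight K u y y pq *
          ((if IkEvent W a b u (pq.1.1 + pq.1.2) (pq.2.1 + pq.2.2) then 1 else 0) +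
            ((if FOne rk pq.1.1 y u n₀ a then 1 else 0) + (if FBand rk pq.1.1 pq.1.2 y u n₀ m₀ then 1 else 0) +
              (if FBand rk pq.1.1 pq.1.2 y u M₀ N₀ then 1 else 0) + (if FOne rk pq.1.1 y u b N₀ then 1 else 0)) +
            ((if FOne rk pq.2.1 y u n₀ a then 1 else 0) + (if FBand rk pq.2.1 pq.2.2 y u n₀ m₀ then 1 else 0) +
              (if FBand rk pq.2.1 pq.2.2 y u M₀ N₀ then 1 else 0) + (if FOne rk pq.2.1 y u b N₀ then 1 else 0))) :=
          ENNReal.tsum_le_tsum fun pq =>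
            prodWeight_mul_indicator_interCount_le hstep hint hrk han hnm hmM hMN hNb hy hW hA pq
      _ = IK + (m₁ * (P * E) + m₂ * (P * E) + m₃ * (P * E) + m₄ * (P * E)) +
            ((P * E) * m₁ + (P * E) * m₂ + (P * E) * m₃ + (P * E) * m₄) := by
          simp only [mul_add, ENNReal.tsum_add]
          rw [e₁, e₂, e₃, e₄, e₁', e₂', e₃', e₄']
      _ = IK + 2 * ((m₁ + m₂ + m₃ + m₄) * (P * E)) := by ring
  -- Part 3: the bounds on `F₁, …, F₄` (`CrossingEventsBounds`)
  have hF1 : m₁ * E ^ 2 ≤ R₁ * E := tsum_epairWeight_fOne_mul_le hK hrk hstep hint y han.le hSn hSa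
  have hF4 : m₄ * E ^ 2 ≤ R₄ * E := tsum_epairWeight_fOne_mul_le hK hrk hstep hint y hNb.le hSb hSN
  have hF2 : m₂ * E ≤ P * R₂ := tsum_epairWeight_fBand_mul_le hK hrk y n₀ m₀ hSn hSm
  have hF3 : m₃ * E ≤ P * R₃ := tsum_epairWeight_fBand_mul_le hK hrk y M₀ N₀ hSM hSN
  have hm₁ : m₁ * E ≤ R₁ := by
    refine (ENNReal.mul_le_mul_iff_left hE0 hEt).1 ?_
    calc m₁ * E * E = m₁ * E ^ 2 := by ring
      _ ≤ R₁ * E := hF1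
  have hm₄ : m₄ * E ≤ R₄ := by
    refine (ENNReal.mul_le_mul_iff_left hE0 hEt).1 ?_
    calc m₄ * E * E = m₄ * E ^ 2 := by ring
      _ ≤ R₄ * E := hF4
  have hBad : 2 * ((m₁ + m₂ + m₃ + m₄) * (P * E)) ≤ c * (P * E) ^ 2 := by
    refine (ENNReal.mul_le_mul_iff_left hE0 hEt).1 ?_
    calc 2 * ((m₁ + m₂ + m₃ + m₄) * (P * E)) * E
        = 2 * (m₁ * E + m₄ * E + (m₂ * E + m₃ * E)) * (P * E) := by ring
      _ ≤ 2 * (R₁ + R₄ + (P * R₂ + P * R₃)) * (P * E) :=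
          mul_le_mul' (mul_le_mul' le_rfl
            (add_le_add (add_le_add hm₁ hm₄) (add_le_add hF2 hF3))) le_rfl
      _ = 2 * ((R₁ + R₄) + P * (R₂ + R₃)) * (P * E) := by ring
      _ ≤ c * (P * E ^ 2) * (P * E) := mul_le_mul' h2 le_rfl
      _ = c * (P * E) ^ 2 * E := by ring
  have hS₀ : S₀ ≤ IK + c * (P * E) ^ 2 := hcover.trans (add_le_add le_rfl hBad)
  -- conclusion
  have hT0 : T₂ ≠ 0 := by
    intro h
    have h' : S₁ ^ 2 * E ^ 2 ≤ 0 := by simpa only [h, mul_zero] using hchain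
    exact mul_ne_zero (pow_ne_zero 2 h0) (pow_ne_zero 2 hE0) (le_antisymm h' bot_le)
  have hTt : T₂ ≠ ∞ :=
    ENNReal.sum_ne_top.2 fun v _ => ENNReal.sum_ne_top.2 fun w _ =>
      ENNReal.mul_ne_top (twoStepBound_ne_top' hK u y v w) (twoStepBound_ne_top' hK u y v w)
  have hkey : c * (P * E) ^ 2 * T₂ + c * (P * E) ^ 2 * T₂ ≤ IK * T₂ + c * (P * E) ^ 2 * T₂ :=
    calc c * (P * E) ^ 2 * T₂ + c * (P * E) ^ 2 * T₂ = 2 * c * (P ^ 2 * T₂) * E ^ 2 := by ring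
      _ ≤ S₁ ^ 2 * E ^ 2 := mul_le_mul' h1 le_rfl
      _ ≤ S₀ * T₂ := hchain
      _ ≤ (IK + c * (P * E) ^ 2) * T₂ := mul_le_mul' hS₀ le_rfl
      _ = IK * T₂ + c * (P * E) ^ 2 * T₂ := by ring
  have hfin : c * (P * E) ^ 2 * T₂ ≠ ∞ :=
    ENNReal.mul_ne_top (ENNReal.mul_ne_top hc (ENNReal.pow_ne_top (ENNReal.mul_ne_top hPt hEt))) hTt
  exact (ENNReal.mul_le_mul_iff_left hT0 hTt).1 ((ENNReal.add_le_add_iff_right hfin).1 hkey)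


open Classical in
/-- **Aizenman–Duminil-Copin 2021, Lemma 4.4 / Lemma 6.2 — the assembly in the layout
`Current.fourMass` / `Current.fourNrm`** of `IntersectionClusteringInduction` (the un-normalised
`P^{uy,uy,∅,∅}` with the sources on the second current of each pair, as consumed by
`improvedTreeDiagramBound_of_intersection_and_mixing`): under the hypotheses of
`Current.ikMass_lower_bound_prod`, `c · fourNrm K u y y ≤ fourMass K u y y 𝟙[I_k]`.
[cite: AizenmanDuminilCopinAnnals2021, arXiv:1912.07973 §4.2, Lemma 4.4 (pp. 11–12); §6.1, Lemma 6.2 (p. 21)] -/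
theorem ikMass_lower_bound (hK : ∀ e, 0 ≤ K e) (hrk : Function.Injective rk)
    (hstep : ∀ v w, G.Adj v w → dist u w ≤ dist u v + 1) (hint : ∀ v, ∃ k : ℕ, dist u v = k) {y : V}
    {a n₀ m₀ M₀ N₀ b : ℕ} (han : a < n₀) (hnm : n₀ ≤ m₀) (hmM : m₀ ≤ M₀) (hMN : M₀ ≤ N₀) (hNb : N₀ < b)
    (hy : (b : ℝ) < dist u y) {W : Finset V} (hW : ∀ v, v ∈ W ↔ (a : ℝ) ≤ dist u v ∧ dist u v ≤ b)
    {A : Finset V} (hA : ∀ v ∈ A, (m₀ : ℝ) ≤ dist u v ∧ dist u v ≤ M₀)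
    {Sa Sn Sm SM SN Sb : Finset V} (hSa : ∀ v, dist u v = a → v ∈ Sa) (hSn : ∀ v, dist u v = n₀ → v ∈ Sn)
    (hSm : ∀ v, dist u v = m₀ → v ∈ Sm) (hSM : ∀ v, dist u v = M₀ → v ∈ SM)
    (hSN : ∀ v, dist u v = N₀ → v ∈ SN) (hSb : ∀ v, dist u v = b → v ∈ Sb)
    {c : ℝ≥0∞} (hc : c ≠ ∞)
    (h0 : ∑ v ∈ A, (ecurrentSum K ({y} ∆ {v}) * ecurrentSum K ({u} ∆ {v})) *
        (ecurrentSum K ({y} ∆ {v}) * ecurrentSum K ({u} ∆ {v})) ≠ 0)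
    (h1 : 2 * c * (ecurrentSum K ({u} ∆ {y}) ^ 2 *
        ∑ v ∈ A, ∑ w ∈ A, twoStepBound K u y v w * twoStepBound K u y v w) ≤
      (∑ v ∈ A, (ecurrentSum K ({y} ∆ {v}) * ecurrentSum K ({u} ∆ {v})) *
        (ecurrentSum K ({y} ∆ {v}) * ecurrentSum K ({u} ∆ {v}))) ^ 2)
    (h2 : 2 * ((∑ v ∈ Sn, ∑ w ∈ Sa, ecurrentSum K ({u} ∆ {v}) * ecurrentSum K ({v} ∆ {w}) * ecurrentSum K ({w} ∆ {y}) +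
          ∑ v ∈ Sb, ∑ w ∈ SN, ecurrentSum K ({u} ∆ {v}) * ecurrentSum K ({v} ∆ {w}) * ecurrentSum K ({w} ∆ {y})) +
        ecurrentSum K ({u} ∆ {y}) *
          (∑ v ∈ Sn, ∑ w ∈ Sm, ecurrentSum K ({v} ∆ {w}) ^ 2 +
            ∑ v ∈ SM, ∑ w ∈ SN, ecurrentSum K ({v} ∆ {w}) ^ 2)) ≤
      c * (ecurrentSum K ({u} ∆ {y}) * ecurrentSum K ∅ ^ 2)) :
    c * fourNrm K u y y ≤
      fourMass K u y y (fun pq => if IkEvent W a b u (pq.1.1 + pq.1.2) (pq.2.1 + pq.2.2) then 1 else 0) := by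
  rw [fourNrm_eq_sq, fourMass_eq_tsum_prodWeight_swap]
  refine le_trans (ikMass_lower_bound_prod hK hrk hstep hint han hnm hmM hMN hNb hy hW hA hSa hSn hSm hSM
    hSN hSb hc h0 h1 h2) (le_of_eq (tsum_congr fun pq => ?_))
  simp only [Prod.fst_swap, Prod.snd_swap, add_comm]

open Classical in
/-- **Aizenman–Duminil-Copin 2021, Lemma 4.4 / Lemma 6.2 — the assembly, with the current sums
expressed through a two-point function.** If `Z[{v}Δ{w}] = Z[∅] · g(v,w)` for a real `g ≥ 0` (on a box
of `ℤ^d` with constant coupling `β`, `g = ⟨σ_vσ_w⟩^∅_Λ`), the two hypotheses of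
`Current.ikMass_lower_bound` read, with `s₁ = ∑_{v ∈ A} (g(y,v)g(u,v))²`,
`t₂ = ∑_{v,w ∈ A} (g(u,v)g(v,w)g(w,y) + g(u,w)g(w,v)g(v,y))²`, `r₁ = ∑_{S_{n₀}×S_a} g(u,v)g(v,w)g(w,y)`,
`r₄ = ∑_{S_b×S_{N₀}} g(u,v)g(v,w)g(w,y)`, `r₂ = ∑_{S_{n₀}×S_{m₀}} g(v,w)²`, `r₃ = ∑_{S_{M₀}×S_{N₀}} g(v,w)²`:
`s₁ > 0`, `2c · g(u,y)² t₂ ≤ s₁²` and `2(r₁ + r₄ + g(u,y)(r₂ + r₃)) ≤ c · g(u,y)`; then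
`c · fourNrm K u y y ≤ fourMass K u y y 𝟙[I_k]` ("`P^{0y,0y,∅,∅}_β[I_k] ≥ c`"). These are the two-point
inequalities established on `ℤ⁴` from the infrared bound and the regularity of `y` (p. 21).
[cite: AizenmanDuminilCopinAnnals2021, arXiv:1912.07973 §4.2, proof of Lemma 4.4 (pp. 11–12); §6.1, Lemma 6.2 and its proof (p. 21)] -/
theorem ikMass_lower_bound_of_twoPoint (hK : ∀ e, 0 ≤ K e) (hrk : Function.Injective rk)
    (hstep : ∀ v w, G.Adj v w → dist u w ≤ dist u v + 1) (hint : ∀ v, ∃ k : ℕ, dist u v = k) {y : V}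
    {a n₀ m₀ M₀ N₀ b : ℕ} (han : a < n₀) (hnm : n₀ ≤ m₀) (hmM : m₀ ≤ M₀) (hMN : M₀ ≤ N₀) (hNb : N₀ < b)
    (hy : (b : ℝ) < dist u y) {W : Finset V} (hW : ∀ v, v ∈ W ↔ (a : ℝ) ≤ dist u v ∧ dist u v ≤ b)
    {A : Finset V} (hA : ∀ v ∈ A, (m₀ : ℝ) ≤ dist u v ∧ dist u v ≤ M₀)
    {Sa Sn Sm SM SN Sb : Finset V} (hSa : ∀ v, dist u v = a → v ∈ Sa) (hSn : ∀ v, dist u v = n₀ → v ∈ Sn)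
    (hSm : ∀ v, dist u v = m₀ → v ∈ Sm) (hSM : ∀ v, dist u v = M₀ → v ∈ SM)
    (hSN : ∀ v, dist u v = N₀ → v ∈ SN) (hSb : ∀ v, dist u v = b → v ∈ Sb)
    {g : V → V → ℝ} (hg0 : ∀ v w, 0 ≤ g v w)
    (hg : ∀ v w, ecurrentSum K ({v} ∆ {w}) = ecurrentSum K ∅ * ENNReal.ofReal (g v w))
    {c : ℝ} (hc : 0 ≤ c)
    (h0 : 0 < ∑ v ∈ A, (g y v * g u v) ^ 2)
    (h1 : 2 * c * (g u y ^ 2 * ∑ v ∈ A, ∑ w ∈ A, (g u v * g v w * g w y + g u w * g w v * g v y) ^ 2) ≤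
      (∑ v ∈ A, (g y v * g u v) ^ 2) ^ 2)
    (h2 : 2 * ((∑ v ∈ Sn, ∑ w ∈ Sa, g u v * g v w * g w y + ∑ v ∈ Sb, ∑ w ∈ SN, g u v * g v w * g w y) +
        g u y * (∑ v ∈ Sn, ∑ w ∈ Sm, g v w ^ 2 + ∑ v ∈ SM, ∑ w ∈ SN, g v w ^ 2)) ≤ c * g u y) :
    ENNReal.ofReal c * fourNrm K u y y ≤
      fourMass K u y y (fun pq => if IkEvent W a b u (pq.1.1 + pq.1.2) (pq.2.1 + pq.2.2) then 1 else 0) := by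
  set E := ecurrentSum K (∅ : Finset V) with hE
  have hE0 : E ≠ 0 := ecurrentSum_empty_ne_zero K
  -- nonnegativity bookkeeping
  have hg3 : ∀ v w, 0 ≤ g u v * g v w * g w y + g u w * g w v * g v y := fun _ _ =>
    add_nonneg (mul_nonneg (mul_nonneg (hg0 _ _) (hg0 _ _)) (hg0 _ _))
      (mul_nonneg (mul_nonneg (hg0 _ _) (hg0 _ _)) (hg0 _ _))
  set s₁ := ∑ v ∈ A, (g y v * g u v) ^ 2 with hs₁
  set t₂ := ∑ v ∈ A, ∑ w ∈ A, (g u v * g v w * g w y + g u w * g w v * g v y) ^ 2 with ht₂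
  set r₁ := ∑ v ∈ Sn, ∑ w ∈ Sa, g u v * g v w * g w y with hr₁
  set r₄ := ∑ v ∈ Sb, ∑ w ∈ SN, g u v * g v w * g w y with hr₄
  set r₂ := ∑ v ∈ Sn, ∑ w ∈ Sm, g v w ^ 2 with hr₂
  set r₃ := ∑ v ∈ SM, ∑ w ∈ SN, g v w ^ 2 with hr₃
  have hs₁0 : 0 ≤ s₁ := Finset.sum_nonneg fun v _ => sq_nonneg _
  have ht₂0 : 0 ≤ t₂ := Finset.sum_nonneg fun v _ => Finset.sum_nonneg fun w _ => sq_nonneg _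
  have hr₁0 : 0 ≤ r₁ := Finset.sum_nonneg fun v _ => Finset.sum_nonneg fun w _ =>
    mul_nonneg (mul_nonneg (hg0 _ _) (hg0 _ _)) (hg0 _ _)
  have hr₄0 : 0 ≤ r₄ := Finset.sum_nonneg fun v _ => Finset.sum_nonneg fun w _ =>
    mul_nonneg (mul_nonneg (hg0 _ _) (hg0 _ _)) (hg0 _ _)
  have hr₂0 : 0 ≤ r₂ := Finset.sum_nonneg fun v _ => Finset.sum_nonneg fun w _ => sq_nonneg _
  have hr₃0 : 0 ≤ r₃ := Finset.sum_nonneg fun v _ => Finset.sum_nonneg fun w _ => sq_nonneg _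
  -- the dictionary `Z ↦ g`
  have eP : ecurrentSum K ({u} ∆ {y}) = E * ENNReal.ofReal (g u y) := hg u y
  have eS₁ : ∑ v ∈ A, (ecurrentSum K ({y} ∆ {v}) * ecurrentSum K ({u} ∆ {v})) *
      (ecurrentSum K ({y} ∆ {v}) * ecurrentSum K ({u} ∆ {v})) = E ^ 4 * ENNReal.ofReal s₁ := by
    rw [hs₁, ENNReal.ofReal_sum_of_nonneg (fun v _ => sq_nonneg _), Finset.mul_sum]
    refine Finset.sum_congr rfl fun v _ => ?_
    rw [hg y v, hg u v, ENNReal.ofReal_pow (mul_nonneg (hg0 _ _) (hg0 _ _)), ENNReal.ofReal_mul (hg0 _ _)]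
    ring
  have et : ∀ v w, twoStepBound K u y v w =
      E ^ 3 * ENNReal.ofReal (g u v * g v w * g w y + g u w * g w v * g v y) := by
    intro v w
    unfold twoStepBound
    rw [hg u v, hg v w, hg w y, hg u w, hg w v, hg v y,
      ENNReal.ofReal_add (mul_nonneg (mul_nonneg (hg0 u v) (hg0 v w)) (hg0 w y))
        (mul_nonneg (mul_nonneg (hg0 u w) (hg0 w v)) (hg0 v y)),
      ENNReal.ofReal_mul (mul_nonneg (hg0 u v) (hg0 v w)), ENNReal.ofReal_mul (hg0 u v),
      ENNReal.ofReal_mul (mul_nonneg (hg0 u w) (hg0 w v)), ENNReal.ofReal_mul (hg0 u w)]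
    ring
  have eT₂ : ∑ v ∈ A, ∑ w ∈ A, twoStepBound K u y v w * twoStepBound K u y v w =
      E ^ 6 * ENNReal.ofReal t₂ := by
    rw [ht₂, ENNReal.ofReal_sum_of_nonneg (fun v _ => Finset.sum_nonneg fun w _ => sq_nonneg _),
      Finset.mul_sum]
    refine Finset.sum_congr rfl fun v _ => ?_
    rw [ENNReal.ofReal_sum_of_nonneg (fun w _ => sq_nonneg _), Finset.mul_sum]
    refine Finset.sum_congr rfl fun w _ => ?_
    rw [et v w, ENNReal.ofReal_pow (hg3 v w)]
    ring
  have eR : ∀ S S' : Finset V, ∑ v ∈ S, ∑ w ∈ S',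
      ecurrentSum K ({u} ∆ {v}) * ecurrentSum K ({v} ∆ {w}) * ecurrentSum K ({w} ∆ {y}) =
      E ^ 3 * ENNReal.ofReal (∑ v ∈ S, ∑ w ∈ S', g u v * g v w * g w y) := by
    intro S S'
    rw [ENNReal.ofReal_sum_of_nonneg (fun v _ => Finset.sum_nonneg fun w _ =>
      mul_nonneg (mul_nonneg (hg0 _ _) (hg0 _ _)) (hg0 _ _)), Finset.mul_sum]
    refine Finset.sum_congr rfl fun v _ => ?_
    rw [ENNReal.ofReal_sum_of_nonneg (fun w _ => mul_nonneg (mul_nonneg (hg0 _ _) (hg0 _ _)) (hg0 _ _)),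
      Finset.mul_sum]
    refine Finset.sum_congr rfl fun w _ => ?_
    rw [hg u v, hg v w, hg w y, ENNReal.ofReal_mul (mul_nonneg (hg0 u v) (hg0 v w)),
      ENNReal.ofReal_mul (hg0 u v)]
    ring
  have eQ : ∀ S S' : Finset V, ∑ v ∈ S, ∑ w ∈ S', ecurrentSum K ({v} ∆ {w}) ^ 2 =
      E ^ 2 * ENNReal.ofReal (∑ v ∈ S, ∑ w ∈ S', g v w ^ 2) := by
    intro S S'
    rw [ENNReal.ofReal_sum_of_nonneg (fun v _ => Finset.sum_nonneg fun w _ => sq_nonneg _), Finset.mul_sum]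
    refine Finset.sum_congr rfl fun v _ => ?_
    rw [ENNReal.ofReal_sum_of_nonneg (fun w _ => sq_nonneg _), Finset.mul_sum]
    refine Finset.sum_congr rfl fun w _ => ?_
    rw [hg v w, ENNReal.ofReal_pow (hg0 _ _)]
    ring
  -- the three hypotheses in current-sum form
  have h0' : ∑ v ∈ A, (ecurrentSum K ({y} ∆ {v}) * ecurrentSum K ({u} ∆ {v})) *
      (ecurrentSum K ({y} ∆ {v}) * ecurrentSum K ({u} ∆ {v})) ≠ 0 := by
    rw [eS₁]
    exact mul_ne_zero (pow_ne_zero 4 hE0) (ENNReal.ofReal_pos.2 h0).ne'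
  have h1' : 2 * ENNReal.ofReal c * (ecurrentSum K ({u} ∆ {y}) ^ 2 *
      ∑ v ∈ A, ∑ w ∈ A, twoStepBound K u y v w * twoStepBound K u y v w) ≤
      (∑ v ∈ A, (ecurrentSum K ({y} ∆ {v}) * ecurrentSum K ({u} ∆ {v})) *
        (ecurrentSum K ({y} ∆ {v}) * ecurrentSum K ({u} ∆ {v}))) ^ 2 := by
    rw [eS₁, eT₂, eP]
    calc 2 * ENNReal.ofReal c * ((E * ENNReal.ofReal (g u y)) ^ 2 * (E ^ 6 * ENNReal.ofReal t₂))
        = E ^ 8 * (2 * ENNReal.ofReal c * (ENNReal.ofReal (g u y) ^ 2 * ENNReal.ofReal t₂)) := by ring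
      _ = E ^ 8 * ENNReal.ofReal (2 * c * (g u y ^ 2 * t₂)) := by
          rw [ENNReal.ofReal_mul (by positivity), ENNReal.ofReal_mul zero_le_two,
            ENNReal.ofReal_mul (sq_nonneg _), ENNReal.ofReal_pow (hg0 _ _), ENNReal.ofReal_ofNat]
      _ ≤ E ^ 8 * ENNReal.ofReal (s₁ ^ 2) := mul_le_mul' le_rfl (ENNReal.ofReal_le_ofReal h1)
      _ = (E ^ 4 * ENNReal.ofReal s₁) ^ 2 := by rw [ENNReal.ofReal_pow hs₁0]; ring
  have h2' : 2 * ((∑ v ∈ Sn, ∑ w ∈ Sa,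
        ecurrentSum K ({u} ∆ {v}) * ecurrentSum K ({v} ∆ {w}) * ecurrentSum K ({w} ∆ {y}) +
          ∑ v ∈ Sb, ∑ w ∈ SN,
            ecurrentSum K ({u} ∆ {v}) * ecurrentSum K ({v} ∆ {w}) * ecurrentSum K ({w} ∆ {y})) +
        ecurrentSum K ({u} ∆ {y}) *
          (∑ v ∈ Sn, ∑ w ∈ Sm, ecurrentSum K ({v} ∆ {w}) ^ 2 +
            ∑ v ∈ SM, ∑ w ∈ SN, ecurrentSum K ({v} ∆ {w}) ^ 2)) ≤
      ENNReal.ofReal c * (ecurrentSum K ({u} ∆ {y}) * ecurrentSum K ∅ ^ 2) := by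
    rw [eR Sn Sa, eR Sb SN, eQ Sn Sm, eQ SM SN, eP, ← hr₁, ← hr₄, ← hr₂, ← hr₃]
    calc 2 * ((E ^ 3 * ENNReal.ofReal r₁ + E ^ 3 * ENNReal.ofReal r₄) +
          E * ENNReal.ofReal (g u y) * (E ^ 2 * ENNReal.ofReal r₂ + E ^ 2 * ENNReal.ofReal r₃))
        = E ^ 3 * (2 * ((ENNReal.ofReal r₁ + ENNReal.ofReal r₄) +
            ENNReal.ofReal (g u y) * (ENNReal.ofReal r₂ + ENNReal.ofReal r₃))) := by ring
      _ = E ^ 3 * ENNReal.ofReal (2 * ((r₁ + r₄) + g u y * (r₂ + r₃))) := by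
          rw [ENNReal.ofReal_mul zero_le_two, ENNReal.ofReal_ofNat,
            ENNReal.ofReal_add (add_nonneg hr₁0 hr₄0) (mul_nonneg (hg0 _ _) (add_nonneg hr₂0 hr₃0)),
            ENNReal.ofReal_add hr₁0 hr₄0, ENNReal.ofReal_mul (hg0 _ _), ENNReal.ofReal_add hr₂0 hr₃0]
      _ ≤ E ^ 3 * ENNReal.ofReal (c * g u y) := mul_le_mul' le_rfl (ENNReal.ofReal_le_ofReal h2)
      _ = ENNReal.ofReal c * (E * ENNReal.ofReal (g u y) * E ^ 2) := by
          rw [ENNReal.ofReal_mul hc]; ring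
  exact ikMass_lower_bound hK hrk hstep hint han hnm hmM hMN hNb hy hW hA hSa hSn hSm hSM hSN hSb
    ENNReal.ofReal_ne_top h0' h1' h2'

end Metric

end Current

end Literature.Probability.LatticeModels
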